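import Literature.Analysis.Pluripotential.ChartPotentialIntegrability
import Literature.Analysis.Pluripotential.MollifierLeviConvergence
import Literature.Analysis.Pluripotential.MongeAmpereMassAllOrders
import Literature.Analysis.Pluripotential.RegularisedMax
import Literature.Analysis.Pluripotential.MongeAmpereStokes
import Literature.Analysis.Pluripotential.MongeAmpereComparison
import HarnessLib

/-!
# Proof of the BEGZ mass bound (regular part): `∫_{Reg T} (dd^c g)^j ∧ ω^{N-j} ≤ (deg T)^j`

Topic `Literature/Analysis/Pluripotential`. This file DISCHARGES the named fact
`BoucksomEtAl2010_regularMass_le_degree_pow` of `NonPluripolarMongeAmpereMass.lean`: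
`theorem BoucksomEtAl2010_regularMass_le_degree_pow_holds`. The printed proof
([BoucksomEtAl2010, Prop. 1.20]: comparison of non-pluripolar masses via Bedford–Taylor theory
and Stokes on the compact Kähler manifold `ℙᴺ`) is replaced by an elementary regularisation
argument available over Mathlib, organised as follows (each step in its own file):

* (P1) `LeviForm`, `RegularLocusLeviForm` — on the `C²` locus the chart potential `g` of a closed
  positive `(1,1)`-current has positive semidefinite Levi matrix;
* (P2) `FubiniStudyLeviMatrix`, `LinearAlgebra/Matrix/PosSemidefPencilCoeff` — hence all the
  densities `heightDensity j g` are `≥ 0` there (`ω_FS > 0` explicitly);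
* (P3) `PshLocalIntegrability`, `ChartPotentialIntegrability` — `g ∈ L¹_loc`, poles are null,
  `g` has the sub-mean-value property at every non-pole, `g ≤ c·fs + C₀` (`c = deg T`);
* (P4) `MollifierSubMeanValue`, `MollifierLeviConvergence` — the mollifications `g_ε = ρ_ε ⋆ g`
  are smooth, psh (densities `≥ 0` everywhere), `≤ c·fs + C₁`, and their densities converge to
  those of `g` pointwise on the `C²` locus;
* (P6, P7) `WirtingerDerivatives`, `MongeAmpereMassInvariance`, `MongeAmpereMassAllOrders`,
  `FubiniStudyMongeAmpereMass` — for `ψ ∈ C_c^∞`, `∫ heightDensity j (κ·fs + ψ) = κ^j`;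
* (P5, here) gluing by the regularised maximum (`RegularisedMax`): for `K` compact and `δ > 0`,
  `v = smoothMax 1 (g_ε) ((c+δ)·fs - k)` equals `g_ε` near `K` (for `k` large) and `(c+δ)·fs - k`
  near infinity (growth), is smooth and psh, and `v = (c+δ)·fs + ψ - k` with `ψ ∈ C_c^∞`; so
  `∫_K dens_j(g_ε) = ∫_K dens_j(v) ≤ ∫ dens_j(v) = (c+δ)^j`
  (`setLIntegral_heightDensity_mollified_le`); Fatou along `ε → 0` on compact `K ⊆ Reg T` and
  `δ → 0` give `∫_K dens_j(g) ≤ c^j` (`setLIntegral_heightDensity_le_of_isCompact`), and an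
  exhaustion of the open regular locus by compact sets (`exists_compact_exhaustion`, monotone
  convergence) gives the claim. Small glue lemmas are reused from `MongeAmpereStokes`
  (`leviMatrix_congr_of_eventuallyEq`) and `MongeAmpereComparison`
  (`levi_nonneg_of_posSemidef_leviMatrix`).

## References

* [BoucksomEtAl2010] S. Boucksom, P. Eyssidieux, V. Guedj, A. Zeriahi, Monge–Ampère equations in
  big cohomology classes, Acta Math. 205 (2010), Prop. 1.20 with Def. 1.1, Prop. 1.4, Prop. 1.6.
* [HormanderSCV1973] L. Hörmander, An introduction to complex analysis in several variables,
  Thm. 1.6.3, §2.6 (regularisation of psh functions).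
* [GuedjZeriahi2017] V. Guedj, A. Zeriahi, Degenerate complex Monge–Ampère equations, Ch. 3.
-/

noncomputable section

open scoped Topology ENNReal Convolution ContDiff ComplexOrder Matrix Polynomial
open MeasureTheory Filter Set Metric Complex ContinuousLinearMap Polynomial Matrix
open Literature.AlgebraicGeometry.HodgeTheory.BiextensionHeight (leviMatrix fsPotential
    heightDensity
  chartVec)

namespace Literature.Analysis.Pluripotential

/-! ## The discharge: `∫_{Reg T} (dd^c g)^j ∧ ω^{N-j} ≤ (deg T)^j` -/

section Assembly

variable {N : ℕ}

/-- The `j`-th pencil coefficient is a continuous function of the first matrix. [folklore] -/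
theorem continuous_coeff_det_X_smul_add_left (G : Matrix (Fin N) (Fin N) ℂ) (j : ℕ) :
    Continuous fun A : Matrix (Fin N) (Fin N) ℂ ↦
      (Matrix.det ((X : ℂ[X]) • A.map C + G.map C)).coeff j := by
  simp only [coeff_det_X_smul_add_eq]
  refine continuous_finsetSum _ fun σ _ ↦ continuous_const.mul
    (continuous_finsetSum _ fun S _ ↦ (continuous_finsetProd _ fun i _ ↦ ?_).mul
      continuous_const)
  exact (continuous_apply i).comp (continuous_apply (σ i))

/-- The density only depends on the Levi matrix. [folklore] -/
theorem heightDensity_congr_of_leviMatrix_eq (j : ℕ) {u u' : (Fin N → ℂ) → ℝ} {w : Fin N → ℂ}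
    (h : leviMatrix u w = leviMatrix u' w) : heightDensity j u w = heightDensity j u' w := by
  rw [heightDensity_eq_coeff_pencil, heightDensity_eq_coeff_pencil, h]

/-- **Pointwise convergence of the Monge–Ampère densities of the mollifications on the `C²`
locus.** [folklore] -/
theorem tendsto_heightDensity_normed_convolution {ι : Type*} {l : Filter ι}
    {φ : ι → ContDiffBump (0 : Fin N → ℂ)} (hφ : Tendsto (fun i ↦ (φ i).rOut) l (𝓝 0))
    {g : (Fin N → ℂ) → ℝ} {Ω : Set (Fin N → ℂ)} (hΩ : IsOpen Ω)
    (hg : ∀ y ∈ Ω, ContDiffAt ℝ 2 g y) {w : Fin N → ℂ} (hw : w ∈ Ω) (j : ℕ) :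
    Tendsto (fun i ↦ heightDensity j ((φ i).normed volume ⋆[lsmul ℝ ℝ, volume] g) w) l
      (𝓝 (heightDensity j g w)) := by
  have hmat : Tendsto (fun i ↦ leviMatrix ((φ i).normed volume ⋆[lsmul ℝ ℝ, volume] g) w) l
      (𝓝 (leviMatrix g w)) := by
    refine tendsto_pi_nhds.2 fun p ↦ tendsto_pi_nhds.2 fun q ↦ ?_
    exact tendsto_leviMatrix_normed_convolution hφ hΩ hg hw p q
  simp only [heightDensity_eq_coeff_pencil]
  refine Tendsto.const_mul _ ((continuous_re.tendsto _).comp ?_)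
  exact ((continuous_coeff_det_X_smul_add_left (leviMatrix fsPotential w) j).tendsto _).comp hmat

/-- The density of a smooth function is continuous. [folklore] -/
theorem continuous_heightDensity {u : (Fin N → ℂ) → ℝ} (hu : ContDiff ℝ ∞ u) (j : ℕ) :
    Continuous fun w ↦ heightDensity j u w := by
  simp only [heightDensity_eq_coeff_pencil]
  exact continuous_const.mul (continuous_re.comp (continuous_coeff_pencil hu j))

/-- On the open set where `g` is `C²`, `w ↦ heightDensity j g w` is continuous. [folklore] -/
theorem continuousOn_heightDensity {g : (Fin N → ℂ) → ℝ} {Ω : Set (Fin N → ℂ)} (hΩ : IsOpen Ω)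
    (hg : ∀ y ∈ Ω, ContDiffAt ℝ 2 g y) (j : ℕ) :
    ContinuousOn (fun w ↦ heightDensity j g w) Ω := by
  intro w hw
  -- near `w`, `g` agrees with a `C²` compactly supported `G`, whose density is continuous
  obtain ⟨δ, hδ, G, hG, -, hGg⟩ := exists_contDiff_two_eqOn hΩ hg hw
  have hnear : ∀ᶠ y in 𝓝 w, heightDensity j g y = heightDensity j G y := by
    filter_upwards [Metric.ball_mem_nhds w hδ] with y hy
    refine heightDensity_congr_of_leviMatrix_eq j (leviMatrix_congr_of_eventuallyEq ?_)
    filter_upwards [Metric.isOpen_ball.mem_nhds hy] with z hz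
    exact (hGg z (ball_subset_closedBall hz)).symm
  have hcontG : Continuous fun y ↦ heightDensity j G y := by
    simp only [heightDensity_eq_coeff_pencil, coeff_det_X_smul_add_eq]
    refine continuous_const.mul (continuous_re.comp ?_)
    refine continuous_finsetSum _ fun σ _ ↦ continuous_const.mul
      (continuous_finsetSum _ fun S _ ↦ (continuous_finsetProd _ fun i _ ↦ ?_).mul
        (continuous_finsetProd _ fun i _ ↦ ?_))
    · have hc : ∀ m : Fin 2 → (Fin N → ℂ), Continuous fun y ↦ iteratedFDeriv ℝ 2 G y m := fun m ↦
        (continuous_eval_const m).comp (hG.continuous_iteratedFDeriv (m := 2) le_rfl)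
      simp only [leviMatrix]
      fun_prop
    · exact continuous_leviMatrix_apply contDiff_fsPotential _ _
  exact ((hcontG.continuousAt.congr (EventuallyEq.symm hnear))).continuousWithinAt

/-- `‖w‖_∞ ≤ exp(fsPotential w)` (`log ‖w‖ ≤ ½ log(1 + |w|²)`). [folklore] -/
theorem norm_le_exp_fsPotential (w : Fin N → ℂ) : ‖w‖ ≤ Real.exp (fsPotential w) := by
  have h2 : ‖w‖ ^ 2 ≤ 1 + ∑ p, ‖w p‖ ^ 2 := by
    rcases (Finset.univ : Finset (Fin N)).eq_empty_or_nonempty with hN | hN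
    · have : ‖w‖ = 0 := by
        refine le_antisymm ((pi_norm_le_iff_of_nonneg le_rfl).mpr fun i ↦ ?_) (norm_nonneg _)
        exact absurd (Finset.mem_univ i) (by simp [hN])
      simp [this, hN]
    · obtain ⟨k, -, hk⟩ := Finset.exists_max_image Finset.univ (fun i ↦ ‖w i‖) hN
      have hwk : ‖w‖ = ‖w k‖ := le_antisymm ((pi_norm_le_iff_of_nonneg (norm_nonneg _)).2
        fun i ↦ hk i (Finset.mem_univ i)) (norm_le_pi_norm w k)
      rw [hwk]
      linarith [Finset.single_le_sum (f := fun p ↦ ‖w p‖ ^ 2) (fun i _ ↦ by positivity)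
        (Finset.mem_univ k)]
  by_cases h0 : ‖w‖ = 0
  · rw [h0]; exact (Real.exp_pos _).le
  · have hpos : 0 < ‖w‖ := lt_of_le_of_ne (norm_nonneg _) (Ne.symm h0)
    have hlog : Real.log ‖w‖ ≤ fsPotential w := by
      rw [fsPotential, le_div_iff₀ two_pos, mul_comm, ← Real.log_rpow hpos, Real.rpow_two]
      exact Real.log_le_log (by positivity) h2
    calc ‖w‖ = Real.exp (Real.log ‖w‖) := (Real.exp_log hpos).symm
      _ ≤ Real.exp (fsPotential w) := Real.exp_le_exp.mpr hlog

/-- Scaling a positive semidefinite complex matrix by a non-negative real keeps it positive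
semidefinite. [folklore] -/
theorem posSemidef_real_smul {M : Matrix (Fin N) (Fin N) ℂ} (hM : M.PosSemidef) {a : ℝ}
    (ha : 0 ≤ a) : ((a : ℂ) • M).PosSemidef := by
  refine Matrix.PosSemidef.of_dotProduct_mulVec_nonneg ?_ fun x ↦ ?_
  · rw [Matrix.IsHermitian, Matrix.conjTranspose_smul, hM.1.eq, Complex.star_def,
      Complex.conj_ofReal]
  · rw [Matrix.smul_mulVec, dotProduct_smul, smul_eq_mul]
    exact mul_nonneg (Complex.zero_le_real.mpr ha) (hM.dotProduct_mulVec_nonneg x)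

/-- **An exhaustion of an open subset of `ℂᴺ` by compact sets** (cf. the equivalent
`RegularMassExhaustion.exhaustion`). [folklore] -/
theorem exists_compact_exhaustion {Ω : Set (Fin N → ℂ)} (hΩ : IsOpen Ω) :
    ∃ K : ℕ → Set (Fin N → ℂ), (∀ n, IsCompact (K n)) ∧ (∀ n, K n ⊆ Ω) ∧ Monotone K ∧
      ⋃ n, K n = Ω := by
  refine ⟨fun n ↦ closedBall 0 n ∩ {w | ∀ y ∉ Ω, (1 : ℝ) / (n + 1) ≤ dist w y}, fun n ↦ ?_,
    fun n w hw ↦ ?_, fun m n hmn w hw ↦ ?_, ?_⟩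
  · refine (isCompact_closedBall 0 n).inter_right ?_
    have : {w : Fin N → ℂ | ∀ y ∉ Ω, (1 : ℝ) / (n + 1) ≤ dist w y} =
        ⋂ y ∈ Ωᶜ, {w | (1 : ℝ) / (n + 1) ≤ dist w y} := by ext w; simp
    rw [this]
    exact isClosed_biInter fun y _ ↦ isClosed_le continuous_const (continuous_id.dist
        continuous_const)
  · by_contra h
    have := hw.2 w h
    rw [dist_self] at this
    exact absurd this (not_le.mpr (by positivity))
  · refine ⟨closedBall_subset_closedBall (by exact_mod_cast hmn) hw.1, fun y hy ↦ ?_⟩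
    refine le_trans ?_ (hw.2 y hy)
    apply one_div_le_one_div_of_le (by positivity)
    exact_mod_cast Nat.add_le_add_right hmn 1
  · refine Subset.antisymm (iUnion_subset fun n w hw ↦ ?_) fun w hw ↦ ?_
    · by_contra h
      have := hw.2 w h
      rw [dist_self] at this
      exact absurd this (not_le.mpr (by positivity))
    · obtain ⟨ε, hε, hball⟩ := Metric.isOpen_iff.mp hΩ w hw
      obtain ⟨n, hn⟩ := exists_nat_ge (max ‖w‖ (1 / ε))
      refine mem_iUnion.mpr ⟨n, ?_, fun y hy ↦ ?_⟩
      · rw [mem_closedBall, dist_zero_right]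
        exact (le_max_left _ _).trans hn
      · have hεn : (1 : ℝ) / (n + 1) ≤ ε := by
          rw [div_le_iff₀ (by positivity)]
          have : 1 / ε ≤ n := (le_max_right _ _).trans hn
          rw [div_le_iff₀ hε] at this
          nlinarith
        refine hεn.trans ?_
        by_contra hlt
        exact hy (hball (by rw [mem_ball, dist_comm]; exact not_le.mp hlt))

end Assembly

section Core

variable {N : ℕ}

namespace ClosedPositiveOneOneCurrent

variable (T : ClosedPositiveOneOneCurrent N)

/-- The a.e. sub-mean-value package of the chart potential (input of the mollifier theory).
[folklore] -/
theorem ae_subMeanValue_chartPotential :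
    ∀ᵐ z : Fin N → ℂ, ∀ (ξ : Fin N → ℂ) (r : ℝ), 0 < r →
      CircleIntegrable (fun τ : ℂ ↦ T.chartPotential (z + τ • ξ)) 0 r ∧
        T.chartPotential z ≤
          Real.circleAverage (fun τ : ℂ ↦ T.chartPotential (z + τ • ξ)) 0 r := by
  filter_upwards [T.ae_pot_chartVec_ne_bot] with z hz ξ r hr
  exact T.chartPotential_le_circleAverage_of_ne_bot hz ξ hr

/-- **The core estimate.** For a compact set `K` (typically inside the regular locus), `δ > 0`
and a normed
bump `φ` of outer radius `≤ 1`, the mollified chart potential `g_φ = ρ ⋆ g` satisfies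
`∫_K heightDensity j g_φ ≤ (deg T + δ)ʲ`: glue `g_φ` (on a neighbourhood of `K`) to
`(c + δ) fs - k` (near infinity) by the regularised maximum; the glued function is smooth, psh
(`levi_smoothMax_nonneg`), equal to `(c+δ) fs + ψ - k` with `ψ ∈ C_c^∞`, so its densities are
`≥ 0` and have total mass `(c+δ)ʲ` (`integral_heightDensity_smul_fsPotential_add`). [folklore] -/
theorem setLIntegral_heightDensity_mollified_le {j : ℕ} (hjN : j ≤ N) {K : Set (Fin N → ℂ)}
    (hK : IsCompact K) {δ : ℝ} (hδ : 0 < δ) (φ : ContDiffBump (0 : Fin N → ℂ)) (hφ : φ.rOut ≤ 1) :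
    ∫⁻ w in K, ENNReal.ofReal
        (heightDensity j (φ.normed volume ⋆[lsmul ℝ ℝ, volume] T.chartPotential) w) ≤
      ENNReal.ofReal ((T.degree + δ) ^ j) := by
  set c := T.degree with hc
  set g := T.chartPotential with hg
  set gφ := φ.normed volume ⋆[lsmul ℝ ℝ, volume] g with hgφ
  have hc0 : 0 ≤ c := T.degree_nonneg
  have hli : LocallyIntegrable g volume := T.locallyIntegrable_chartPotential
  have hsmv := T.ae_subMeanValue_chartPotential
  obtain ⟨C₀, hC₀, hgrow⟩ := T.exists_chartPotential_le
  have hsmooth : ContDiff ℝ ∞ gφ := contDiff_normed_convolution φ hli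
  have hleviφ : ∀ w v, 0 ≤ fderiv ℝ (fderiv ℝ gφ) w v v + fderiv ℝ (fderiv ℝ gφ) w (I • v) (I • v)
      :=
    fun w v ↦ levi_nonneg_of_posSemidef_leviMatrix
      (posSemidef_leviMatrix_normed_convolution φ hli hsmv w) v
  set C₁ : ℝ := C₀ + c * (Real.log (2 * (1 + N)) / 2) with hC₁
  have hgrowφ : ∀ w, gφ w ≤ c * fsPotential w + C₁ :=
    normed_convolution_le_fsPotential φ hφ hli hc0 hgrow
  -- the empty case
  rcases K.eq_empty_or_nonempty with hKe | hKne
  · rw [hKe, Measure.restrict_empty, lintegral_zero_measure]; exact bot_le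
  -- the comparison function `h = (c + δ) fs`
  have hfs : ContDiff ℝ ∞ (fsPotential : (Fin N → ℂ) → ℝ) := contDiff_fsPotential
  set h : (Fin N → ℂ) → ℝ := (c + δ) • (fsPotential : (Fin N → ℂ) → ℝ) with hh
  have hh' : ∀ w, h w = (c + δ) * fsPotential w := fun w ↦ rfl
  have hhs : ContDiff ℝ ∞ h := by rw [hh]; exact hfs.const_smul (c + δ)
  -- the gluing level `k`
  have hcontd : ContinuousOn (fun w ↦ h w - gφ w) K :=
    (hhs.continuous.sub hsmooth.continuous).continuousOn
  obtain ⟨w₀, hw₀, hmax⟩ := hK.exists_isMaxOn hKne hcontd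
  set k : ℝ := h w₀ - gφ w₀ + 2 with hk
  have hK_le : ∀ w ∈ K, h w - k + 2 ≤ gφ w := fun w hw ↦ by
    have h1 : h w - gφ w ≤ h w₀ - gφ w₀ := hmax hw
    rw [hk]; linarith
  -- the glued function
  set v : (Fin N → ℂ) → ℝ := fun w ↦ smoothMax 1 (gφ w) (h w - k) with hv
  have hvs : ContDiff ℝ ∞ v := by
    rw [contDiff_iff_contDiffAt]
    intro w
    exact ContDiffAt.smoothMax (n := ⊤) hsmooth.contDiffAt (hhs.sub contDiff_const).contDiffAt
  -- `v = gφ` on an open neighbourhood `U` of `K`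
  set U : Set (Fin N → ℂ) := {w | h w - k + 1 < gφ w} with hU
  have hUo : IsOpen U := isOpen_lt ((hhs.continuous.sub continuous_const).add continuous_const)
    hsmooth.continuous
  have hKU : K ⊆ U := fun w hw ↦ by
    show h w - k + 1 < gφ w
    linarith [hK_le w hw]
  have hvU : ∀ w ∈ U, v w = gφ w := fun w hw ↦
    smoothMax_eq_left one_pos (by show h w - k + 1 ≤ gφ w; exact le_of_lt hw)
  -- `v = h - k` far away
  set B : ℝ := (C₁ + k + 1) / δ with hB
  have hfar : ∀ w, B ≤ fsPotential w → v w = h w - k := by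
    intro w hw
    refine smoothMax_eq_right one_pos ?_
    have : δ * B ≤ δ * fsPotential w := mul_le_mul_of_nonneg_left hw hδ.le
    rw [hB, mul_div_cancel₀ _ hδ.ne'] at this
    have := hgrowφ w
    show gφ w + 1 ≤ h w - k
    rw [hh']
    nlinarith
  set R : ℝ := Real.exp B with hR
  have hfar' : ∀ w, R < ‖w‖ → v w = h w - k := fun w hw ↦ hfar w (by
    by_contra hlt
    have h1 : Real.exp (fsPotential w) < Real.exp B := Real.exp_lt_exp.mpr (not_le.mp hlt)
    exact absurd ((norm_le_exp_fsPotential w).trans_lt h1) (not_lt.mpr hw.le))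
  -- the compactly supported perturbation `ψ = v - (h - k)`
  set ψ : (Fin N → ℂ) → ℝ := fun w ↦ v w - (h w - k) with hψ
  have hψs : ContDiff ℝ ∞ ψ := hvs.sub (hhs.sub contDiff_const)
  have hψc : HasCompactSupport ψ := by
    refine HasCompactSupport.of_support_subset_isCompact (isCompact_closedBall (0 : Fin N → ℂ) R)
      fun w hw ↦ ?_
    rw [mem_closedBall, dist_zero_right]
    by_contra hgt
    exact hw (by show v w - (h w - k) = 0; rw [hfar' w (not_le.mp hgt), sub_self])
  have hvrepr : v = fun w ↦ ((c + δ) • (fsPotential : (Fin N → ℂ) → ℝ) + ψ) w + (-k) := by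
    funext w
    simp only [hψ, Pi.add_apply]
    ring
  -- densities of `v`: non-negative everywhere, total mass `(c+δ)^j`
  have hleviψ : ∀ w u, 0 ≤ fderiv ℝ (fderiv ℝ (fun w ↦ h w - k)) w u u +
      fderiv ℝ (fderiv ℝ (fun w ↦ h w - k)) w (I • u) (I • u) := by
    intro w u
    refine levi_nonneg_of_posSemidef_leviMatrix ?_ u
    have hL : leviMatrix (fun w ↦ h w - k) w = ((c + δ : ℝ) : ℂ) • leviMatrix fsPotential w := by
      have e1 : (fun w ↦ h w - k) = fun w ↦ h w + (-k) := by funext w; ring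
      rw [e1, leviMatrix_add_const (u := h) hhs (-k) w, hh, leviMatrix_const_smul hfs]
    rw [hL]
    exact posSemidef_real_smul (posDef_leviMatrix_fsPotential w).posSemidef (by linarith)
  have hv2 : ContDiff ℝ 2 v := hvs.of_le (WithTop.coe_le_coe.mpr le_top)
  have hdens_v_nonneg : ∀ w, 0 ≤ heightDensity j v w := by
    intro w
    refine heightDensity_nonneg_of_posSemidef (posSemidef_leviMatrix ?_ fun u ↦ ?_) j
    · intro a b
      exact hv2.contDiffAt.isSymmSndFDerivAt (by simp) a b
    · exact levi_smoothMax_nonneg one_pos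
        (hsmooth.contDiffAt.of_le (WithTop.coe_le_coe.mpr le_top))
        ((hhs.sub contDiff_const).contDiffAt.of_le (WithTop.coe_le_coe.mpr le_top))
        (hleviφ w) (hleviψ w) u
  have hmass := integral_heightDensity_smul_fsPotential_add (κ := c + δ) hψs hψc hjN
  have hus : ContDiff ℝ ∞ ((c + δ) • (fsPotential : (Fin N → ℂ) → ℝ) + ψ) :=
    (hfs.const_smul (c + δ)).add hψs
  have hdens_v_eq : ∀ w, heightDensity j v w =
      heightDensity j ((c + δ) • (fsPotential : (Fin N → ℂ) → ℝ) + ψ) w := by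
    intro w
    rw [hvrepr]
    exact heightDensity_add_const hus (-k) j w
  -- the chain of (in)equalities
  calc ∫⁻ w in K, ENNReal.ofReal (heightDensity j gφ w)
      = ∫⁻ w in K, ENNReal.ofReal (heightDensity j v w) := by
        refine setLIntegral_congr_fun hK.measurableSet fun w hw ↦ ?_
        rw [heightDensity_congr_of_leviMatrix_eq j (leviMatrix_congr_of_eventuallyEq ?_)]
        filter_upwards [hUo.mem_nhds (hKU hw)] with y hy
        exact (hvU y hy).symm
    _ ≤ ∫⁻ w, ENNReal.ofReal (heightDensity j v w) := setLIntegral_le_lintegral _ _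
    _ = ENNReal.ofReal (∫ w, heightDensity j v w) := by
        have hfun : heightDensity j v =
            heightDensity j ((c + δ) • (fsPotential : (Fin N → ℂ) → ℝ) + ψ) := funext hdens_v_eq
        have hint : Integrable (heightDensity j v) volume := by rw [hfun]; exact hmass.1
        exact (ofReal_integral_eq_lintegral_ofReal hint (Eventually.of_forall hdens_v_nonneg)).symm
    _ = ENNReal.ofReal ((c + δ) ^ j) := by
        have hfun : heightDensity j v =
            heightDensity j ((c + δ) • (fsPotential : (Fin N → ℂ) → ℝ) + ψ) := funext hdens_v_eq
        rw [show (∫ w, heightDensity j v w) = ∫ w, heightDensity j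
          ((c + δ) • (fsPotential : (Fin N → ℂ) → ℝ) + ψ) w by rw [hfun], hmass.2]

/-- **The estimate on compact subsets of the regular locus**:
`∫_K (dd^c g)^j ∧ ω^{N-j} ≤ (deg T)ʲ` for every compact `K ⊆ Reg(T)` (Fatou along the
mollifications `ρ_n ⋆ g`, whose densities converge pointwise on `Reg(T)` to those of `g`, then
`δ → 0`). [cite: BoucksomEtAl2010, Prop. 1.20 (regular part)] -/
theorem setLIntegral_heightDensity_le_of_isCompact {j : ℕ} (hjN : j ≤ N) {K : Set (Fin N → ℂ)}
    (hK : IsCompact K) (hKΩ : K ⊆ T.regularLocus) :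
    ∫⁻ w in K, ENNReal.ofReal (heightDensity j T.chartPotential w) ≤
      ENNReal.ofReal (T.degree ^ j) := by
  -- the mollifiers `φ_n` of outer radius `1/(n+2)`
  set φ : ℕ → ContDiffBump (0 : Fin N → ℂ) := fun n ↦
    ⟨1 / (2 * (n + 2)), 1 / (n + 2), by positivity, by
      rw [div_lt_div_iff_of_pos_left one_pos (by positivity) (by positivity)]; linarith⟩ with hφdef
  have hφout : ∀ n, (φ n).rOut = 1 / (n + 2) := fun n ↦ rfl
  have hφ1 : ∀ n, (φ n).rOut ≤ 1 := fun n ↦ by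
    rw [hφout, div_le_one (by positivity)]; linarith
  have hφ0 : Tendsto (fun n ↦ (φ n).rOut) atTop (𝓝 0) := by
    simp only [hφout]
    have h1 : Tendsto (fun n : ℕ ↦ (n : ℝ) + 2) atTop atTop :=
      tendsto_atTop_add_const_right _ 2 tendsto_natCast_atTop_atTop
    exact tendsto_const_nhds.div_atTop h1
  have hΩo : IsOpen T.regularLocus := T.isOpen_regularLocus
  have hreg : ∀ y ∈ T.regularLocus, ContDiffAt ℝ 2 T.chartPotential y := fun y hy ↦ hy
  -- pointwise convergence and Fatou
  have hlim : ∀ w ∈ K, Tendsto (fun n ↦ ENNReal.ofReal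
      (heightDensity j ((φ n).normed volume ⋆[lsmul ℝ ℝ, volume] T.chartPotential) w)) atTop
      (𝓝 (ENNReal.ofReal (heightDensity j T.chartPotential w))) := fun w hw ↦
    (ENNReal.continuous_ofReal.tendsto _).comp
      (tendsto_heightDensity_normed_convolution hφ0 hΩo hreg (hKΩ hw) j)
  have hmeas : ∀ n, AEMeasurable (fun w ↦ ENNReal.ofReal
      (heightDensity j ((φ n).normed volume ⋆[lsmul ℝ ℝ, volume] T.chartPotential) w))
      (volume.restrict K) := fun n ↦
    (ENNReal.continuous_ofReal.comp (continuous_heightDensity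
      (contDiff_normed_convolution (φ n) T.locallyIntegrable_chartPotential) j)).aemeasurable
  have hδ : ∀ δ : ℝ, 0 < δ → ∫⁻ w in K, ENNReal.ofReal (heightDensity j T.chartPotential w) ≤
      ENNReal.ofReal ((T.degree + δ) ^ j) := by
    intro δ hδ
    calc ∫⁻ w in K, ENNReal.ofReal (heightDensity j T.chartPotential w)
        = ∫⁻ w in K, liminf (fun n ↦ ENNReal.ofReal
            (heightDensity j ((φ n).normed volume ⋆[lsmul ℝ ℝ, volume] T.chartPotential) w))
            atTop := setLIntegral_congr_fun hK.measurableSet fun w hw ↦ ((hlim w hw).liminf_eq).symm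
      _ ≤ liminf (fun n ↦ ∫⁻ w in K, ENNReal.ofReal
            (heightDensity j ((φ n).normed volume ⋆[lsmul ℝ ℝ, volume] T.chartPotential) w))
            atTop := lintegral_liminf_le' hmeas
      _ ≤ ENNReal.ofReal ((T.degree + δ) ^ j) :=
          liminf_le_of_le (h := fun b hb ↦ by
            obtain ⟨n, hn⟩ := hb.exists
            exact hn.trans (T.setLIntegral_heightDensity_mollified_le hjN hK hδ (φ n) (hφ1 n)))
  -- `δ → 0`
  have htend : Tendsto (fun m : ℕ ↦ ENNReal.ofReal ((T.degree + 1 / ((m : ℝ) + 1)) ^ j)) atTop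
      (𝓝 (ENNReal.ofReal (T.degree ^ j))) := by
    refine (ENNReal.continuous_ofReal.tendsto _).comp ?_
    have : Tendsto (fun m : ℕ ↦ T.degree + 1 / ((m : ℝ) + 1)) atTop (𝓝 (T.degree + 0)) :=
      tendsto_const_nhds.add tendsto_one_div_add_atTop_nhds_zero_nat
    rw [add_zero] at this
    exact (this.pow j)
  exact ge_of_tendsto' htend fun m ↦ hδ _ (by positivity)

end ClosedPositiveOneOneCurrent

/-- **BEGZ mass bound, regular part** — the discharge of
`BoucksomEtAl2010_regularMass_le_degree_pow`: for every closed positive `(1,1)`-current `T` on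
`ℙᴺ(ℂ)` and `1 ≤ j ≤ N`, `∫_{Reg T} (dd^c g)^j ∧ ω_FS^{N-j} ≤ (deg T)^j`. Proof: exhaust the
open regular locus by compact sets (monotone convergence) and apply
`setLIntegral_heightDensity_le_of_isCompact`; the latter rests on the positivity of the Levi
form of the chart potential (`LeviForm`, `RegularLocusLeviForm`), the local integrability and
a.e. sub-mean-value property of the chart potential (`PshLocalIntegrability`,
`ChartPotentialIntegrability`), the mollifier theory (`MollifierSubMeanValue`,
`MollifierLeviConvergence`), the regularised maximum (`RegularisedMax`), and the mass identities
for smooth compactly perturbed multiples of the Fubini–Study potential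
(`MongeAmpereMassInvariance`, `MongeAmpereMassAllOrders`, `FubiniStudyMongeAmpereMass`).
[cite: BoucksomEtAl2010, Prop. 1.20 (with Def. 1.1 and Prop. 1.4)] -/
theorem BoucksomEtAl2010_regularMass_le_degree_pow_holds :
    BoucksomEtAl2010_regularMass_le_degree_pow := by
  intro N T j hj1 hjN
  obtain ⟨K, hKc, hKΩ, hKmono, hKU⟩ := exists_compact_exhaustion T.isOpen_regularLocus
  set F : (Fin N → ℂ) → ℝ≥0∞ := fun w ↦ ENNReal.ofReal (heightDensity j T.chartPotential w) with hF
  have hFm : AEMeasurable F (volume.restrict T.regularLocus) :=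
    (ENNReal.continuous_ofReal.comp_continuousOn (continuousOn_heightDensity
      T.isOpen_regularLocus (fun y hy ↦ hy) j)).aemeasurable T.measurableSet_regularLocus
  rw [ClosedPositiveOneOneCurrent.regularMass]
  -- monotone convergence along the exhaustion
  have hsup : ∀ᵐ w ∂(volume.restrict T.regularLocus),
      F w = ⨆ n, (K n).indicator F w := by
    filter_upwards [ae_restrict_mem T.measurableSet_regularLocus] with w hw
    have hwK : ∃ n, w ∈ K n := by
      have : w ∈ ⋃ n, K n := by rw [hKU]; exact hw
      exact mem_iUnion.mp this
    obtain ⟨n, hn⟩ := hwK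
    apply le_antisymm
    · exact le_iSup_of_le n (by rw [indicator_of_mem hn])
    · exact iSup_le fun m ↦ indicator_le_self _ _ _
  calc ∫⁻ w in T.regularLocus, F w
      = ∫⁻ w in T.regularLocus, ⨆ n, (K n).indicator F w := lintegral_congr_ae hsup
    _ = ⨆ n, ∫⁻ w in T.regularLocus, (K n).indicator F w := by
        refine lintegral_iSup' (fun n ↦ hFm.indicator (hKc n).measurableSet) ?_
        exact Eventually.of_forall fun w m n hmn ↦
          indicator_le_indicator_of_subset (hKmono hmn) (fun _ ↦ bot_le) w
    _ = ⨆ n, ∫⁻ w in K n, F w := by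
        congr 1; funext n
        rw [setLIntegral_indicator (hKc n).measurableSet, Set.inter_eq_left.mpr (hKΩ n)]
    _ ≤ ENNReal.ofReal (T.degree ^ j) :=
        iSup_le fun n ↦ T.setLIntegral_heightDensity_le_of_isCompact hjN (hKc n) (hKΩ n)

end Core

end Literature.Analysis.Pluripotential

end
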